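import Mathlib

/-!
# The Feshbach–Schur gain bound for the bottom of a symmetric form

Topic `Literature/Analysis/InnerProduct` (next to `RankOneInertia`, `RankOneSecular`). Let `T` be a
symmetric operator on a real inner product space, `φ` a UNIT trial vector with Rayleigh value
`ε = ⟪T φ, φ⟫`, and `w ⊥ φ` a correction with COUPLING `β = ⟪T φ, w⟫` and EXCESS STIFFNESS
`γ = ⟪T w, w⟫ − ε ‖w‖²`. Then for every real `s`

  `⟪T (φ + s w), φ + s w⟫ − ε ‖φ + s w‖² = 2 s β + s² γ`            (`feshbach_trial_identity`);

hence if `γ > 0` the choice `s = −β/γ` lowers the Rayleigh quotient strictly below `ε` as soon as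
`β ≠ 0`, and every lower bound `μ` of the form (`μ ‖x‖² ≤ ⟪T x, x⟫` for all `x`; e.g. the bottom of
the spectrum, min–max principle) obeys the GAIN BOUND

  `μ ≤ ε − β² γ / (γ² + β² ‖w‖²)`                                      (`formLowerBound_le_sub_gain`),

and, when `w` already solves the reduced ("strip") problem in the sense `⟪T φ, w⟫ = −G`,
`⟪T w, w⟫ − ε ‖w‖² = G` (i.e. `w = −(C − ε)⁻¹ b` for the block decomposition `T = [[ε, bᵀ], [b, C]]`,
`G = ⟪b, (C − ε)⁻¹ b⟫`), the SCHUR-COMPLEMENT form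

  `μ ≤ ε − G / (1 + ‖w‖²)`                                            (`formLowerBound_le_sub_schur`).

This is the variational (upper-bound) half of the Feshbach–Schur reduction of an eigenvalue problem
to a complementary block: the exact bottom `μ` solves `ε − μ = ⟪b, (C − μ)⁻¹ b⟫` when `φ` is an
eigenvector of the compressed operator; the lemmas here give the first-order consequence
`μ ≤ ε − ⟪b, (C − ε)⁻¹ b⟫ (1 + o(1))` with an explicit denominator, which is the form in which
Hadamard-type domain-variation bounds are obtained from a boundary-layer corrector. Printed forms:
the min–max / Rayleigh–Ritz principle, Reed–Simon IV Thm XIII.1–XIII.3 (pp. 76–82), and the Schur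
complement criterion, Horn–Johnson Thm 7.7.7 / (0.8.5); the first-order coefficient of an analytic
family of forms is Kato VII-§4.6 eq. (4.44). [Kato1966, VII-§4.6 (4.44); HornJohnson2013, Thm 7.7.7]

No definitions, no named facts, no finite-dimensionality; pure algebra of a symmetric form.
-/

noncomputable section

open scoped InnerProductSpace RealInnerProductSpace

namespace Literature.Analysis.InnerProduct

variable {E : Type*} [NormedAddCommGroup E] [InnerProductSpace ℝ E]

/-- **Feshbach trial identity.** For a symmetric `T`, a unit vector `φ` with `⟪T φ, φ⟫ = ε` and a
correction `w ⊥ φ` with coupling `⟪T φ, w⟫ = β` and excess stiffness `⟪T w, w⟫ − ε ‖w‖² = γ`: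
`⟪T (φ + s w), φ + s w⟫ − ε ‖φ + s w‖² = 2 s β + s² γ`. [cite: Kato1966, VII-§4.6 (4.44)] -/
theorem feshbach_trial_identity (T : E →ₗ[ℝ] E) (hsym : ∀ x y : E, ⟪T x, y⟫_ℝ = ⟪x, T y⟫_ℝ)
    {φ w : E} {ε β γ : ℝ} (hφ : ‖φ‖ = 1) (horth : ⟪φ, w⟫_ℝ = 0) (hε : ⟪T φ, φ⟫_ℝ = ε)
    (hβ : ⟪T φ, w⟫_ℝ = β) (hγ : ⟪T w, w⟫_ℝ - ε * ‖w‖ ^ 2 = γ) (s : ℝ) :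
    ⟪T (φ + s • w), φ + s • w⟫_ℝ - ε * ‖φ + s • w‖ ^ 2 = 2 * s * β + s ^ 2 * γ := by
  have hwφ : ⟪T w, φ⟫_ℝ = β := by rw [hsym, real_inner_comm, hβ]
  have hnorm : ‖φ + s • w‖ ^ 2 = 1 + s ^ 2 * ‖w‖ ^ 2 := by
    rw [norm_add_sq_real, real_inner_smul_right, horth, norm_smul, Real.norm_eq_abs, mul_pow,
      sq_abs, hφ]
    ring
  have hform : ⟪T (φ + s • w), φ + s • w⟫_ℝ = ε + 2 * s * β + s ^ 2 * ⟪T w, w⟫_ℝ := by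
    rw [map_add, map_smul, inner_add_left, inner_add_right, inner_add_right, inner_smul_left,
      inner_smul_left, inner_smul_right, inner_smul_right, hε, hβ, hwφ]
    simp only [conj_trivial]
    ring
  rw [hform, hnorm, ← hγ]
  ring

/-- **Gain bound.** If `μ` is a lower bound of the form `x ↦ ⟪T x, x⟫` (`μ ‖x‖² ≤ ⟪T x, x⟫` for all
`x`), `φ` is a unit vector with `⟪T φ, φ⟫ = ε`, and `w ⊥ φ` has coupling `β` and POSITIVE excess
stiffness `γ`, then `μ ≤ ε − β² γ / (γ² + β² ‖w‖²)`: the trial vector `φ − (β/γ) w` realises the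
gain. [cite: HornJohnson2013, Thm 7.7.7] -/
theorem formLowerBound_le_sub_gain (T : E →ₗ[ℝ] E) (hsym : ∀ x y : E, ⟪T x, y⟫_ℝ = ⟪x, T y⟫_ℝ)
    {φ w : E} {ε β γ μ : ℝ} (hμ : ∀ x : E, μ * ‖x‖ ^ 2 ≤ ⟪T x, x⟫_ℝ) (hφ : ‖φ‖ = 1)
    (horth : ⟪φ, w⟫_ℝ = 0) (hε : ⟪T φ, φ⟫_ℝ = ε) (hβ : ⟪T φ, w⟫_ℝ = β)
    (hγ : ⟪T w, w⟫_ℝ - ε * ‖w‖ ^ 2 = γ) (hγpos : 0 < γ) :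
    μ ≤ ε - β ^ 2 * γ / (γ ^ 2 + β ^ 2 * ‖w‖ ^ 2) := by
  set s : ℝ := -β / γ with hs
  have hγne : γ ≠ 0 := hγpos.ne'
  have hsγ : s * γ = -β := by rw [hs, div_mul_cancel₀ _ hγne]
  have hid := feshbach_trial_identity T hsym hφ horth hε hβ hγ s
  have hnorm : ‖φ + s • w‖ ^ 2 = 1 + s ^ 2 * ‖w‖ ^ 2 := by
    rw [norm_add_sq_real, real_inner_smul_right, horth, norm_smul, Real.norm_eq_abs, mul_pow,
      sq_abs, hφ]
    ring
  -- `⟪T x, x⟫ = ε ‖x‖² − β²/γ` and `‖x‖² γ² = γ² + β² ‖w‖²` for `x = φ + s w`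
  have hs2 : s ^ 2 * γ = -(s * β) := by
    rw [sq, mul_assoc, hsγ]; ring
  have hval : 2 * s * β + s ^ 2 * γ = -(β ^ 2 / γ) := by
    rw [hs2, hs]; ring
  have hTx : ⟪T (φ + s • w), φ + s • w⟫_ℝ = ε * (1 + s ^ 2 * ‖w‖ ^ 2) - β ^ 2 / γ := by
    rw [hnorm] at hid; linarith
  have h1 : μ * (1 + s ^ 2 * ‖w‖ ^ 2) ≤ ε * (1 + s ^ 2 * ‖w‖ ^ 2) - β ^ 2 / γ := by
    have hx := hμ (φ + s • w)
    rw [hnorm, hTx] at hx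
    exact hx
  have hsq : s ^ 2 * γ ^ 2 = β ^ 2 := by rw [← mul_pow, hsγ, neg_sq]
  have h2 : (1 + s ^ 2 * ‖w‖ ^ 2) * γ ^ 2 = γ ^ 2 + β ^ 2 * ‖w‖ ^ 2 := by
    linear_combination ‖w‖ ^ 2 * hsq
  have h3 : β ^ 2 / γ * γ ^ 2 = β ^ 2 * γ := by
    rw [sq γ, ← mul_assoc, div_mul_cancel₀ _ hγne]
  have hγ2 : 0 < γ ^ 2 := by positivity
  have hD : 0 < γ ^ 2 + β ^ 2 * ‖w‖ ^ 2 := by positivity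
  have hkey : μ * (γ ^ 2 + β ^ 2 * ‖w‖ ^ 2) ≤ ε * (γ ^ 2 + β ^ 2 * ‖w‖ ^ 2) - β ^ 2 * γ := by
    have := mul_le_mul_of_nonneg_right h1 hγ2.le
    rw [sub_mul, mul_assoc μ, mul_assoc ε, h2, h3] at this
    exact this
  have hfin : β ^ 2 * γ / (γ ^ 2 + β ^ 2 * ‖w‖ ^ 2) ≤ ε - μ := by
    rw [div_le_iff₀ hD]; linarith
  linarith

/-- **Schur-complement form of the gain bound.** If the correction `w ⊥ φ` solves the reduced
problem, `⟪T φ, w⟫ = −G` and `⟪T w, w⟫ − ε ‖w‖² = G` with `G > 0` (for a block decomposition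
`T = [[ε, bᵀ], [b, C]]` this is `w = −(C − ε)⁻¹ b`, `G = ⟪b, (C − ε)⁻¹ b⟫`), then every lower
bound `μ` of the form satisfies `μ ≤ ε − G / (1 + ‖w‖²)`. [cite: HornJohnson2013, Thm 7.7.7] -/
theorem formLowerBound_le_sub_schur (T : E →ₗ[ℝ] E) (hsym : ∀ x y : E, ⟪T x, y⟫_ℝ = ⟪x, T y⟫_ℝ)
    {φ w : E} {ε G μ : ℝ} (hμ : ∀ x : E, μ * ‖x‖ ^ 2 ≤ ⟪T x, x⟫_ℝ) (hφ : ‖φ‖ = 1)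
    (horth : ⟪φ, w⟫_ℝ = 0) (hε : ⟪T φ, φ⟫_ℝ = ε) (hβ : ⟪T φ, w⟫_ℝ = -G)
    (hγ : ⟪T w, w⟫_ℝ - ε * ‖w‖ ^ 2 = G) (hG : 0 < G) :
    μ ≤ ε - G / (1 + ‖w‖ ^ 2) := by
  have h := formLowerBound_le_sub_gain T hsym hμ hφ horth hε hβ hγ hG
  have hD : 0 < G ^ 2 + (-G) ^ 2 * ‖w‖ ^ 2 := by positivity
  have hrw : (-G) ^ 2 * G / (G ^ 2 + (-G) ^ 2 * ‖w‖ ^ 2) = G / (1 + ‖w‖ ^ 2) := by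
    rw [div_eq_div_iff hD.ne' (by positivity)]
    ring
  rwa [hrw] at h

/-- **No gain without coupling, strict gain with it.** Under the hypotheses of
`formLowerBound_le_sub_gain`, if the coupling `β` is nonzero then the bottom lies STRICTLY below
the trial value `ε`. [cite: HornJohnson2013, Thm 7.7.7] -/
theorem formLowerBound_lt_of_coupling_ne_zero (T : E →ₗ[ℝ] E)
    (hsym : ∀ x y : E, ⟪T x, y⟫_ℝ = ⟪x, T y⟫_ℝ) {φ w : E} {ε β γ μ : ℝ}
    (hμ : ∀ x : E, μ * ‖x‖ ^ 2 ≤ ⟪T x, x⟫_ℝ) (hφ : ‖φ‖ = 1) (horth : ⟪φ, w⟫_ℝ = 0)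
    (hε : ⟪T φ, φ⟫_ℝ = ε) (hβ : ⟪T φ, w⟫_ℝ = β) (hγ : ⟪T w, w⟫_ℝ - ε * ‖w‖ ^ 2 = γ)
    (hγpos : 0 < γ) (hβne : β ≠ 0) : μ < ε := by
  have h := formLowerBound_le_sub_gain T hsym hμ hφ horth hε hβ hγ hγpos
  have hpos : 0 < β ^ 2 * γ / (γ ^ 2 + β ^ 2 * ‖w‖ ^ 2) := by
    have hβ2 : 0 < β ^ 2 := by positivity
    positivity
  linarith

end Literature.Analysis.InnerProduct

end
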